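import Summits.BirchSwinnertonDyer.Rank1Residual.Additive.TameBranchLambdaParityLaw
import HarnessLib

/-!
# THE PARITY OF `λ` ON THE TAME BRANCH at rank one — the TWO-SIDED sandwich
# `μ(X) + 1 + 2 ord #tors ≤ ord Ш[p^∞] + ord Reg_p + ord ∏c + ord ℓ ≤ μ(X) + ord_p[T¹]B + c + 1 + 2 ord #tors`
# (left `=` iff `λ(X) = 1`, right `=` iff `λ(X) = λ_an`), `λ(X)` ODD, the DICHOTOMY at `λ_an = 3` and
# the SQUEEZE ⟹ the λ-part ⟹ the rational main conjecture AT THE PAIR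
# (cell `b2b-bsdres`, sub-cell additive-p2 = X3♯(G-ord)/X4♯(G-ord), gen 30; part 2)

HONEST FRAMING (cell `b2b-bsdres`, run/shared/lean/b2b/bsd-rank1-residual/, verbatim in every
file): the goal of the cell is to DELETE the COMBINATION-SHAPED residual classes of the
Birch–Swinnerton-Dyer formula for ALL analytic-rank `≤ 1` elliptic curves over `ℚ` — "full BSD
formula for every rank `≤ 1` curve in class `C`" assembled STRICTLY from published theorems — so
that the rank-`≤ 1` remainder becomes exactly the CONSTRUCTION-SHAPED classes, which are TYPED
(missing-input `Prop`s), NOT attempted. This is not "finishing BSD". Sub-cell additive-p2: the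
classes X3♯(G-ord) / X4♯(G-ord) are CONSTRUCTION-SHAPED and stay so; labels / RESIDUAL-MAP marks
UNCHANGED; nothing is booked. Theorems only; the published inputs are hypothesis binders (Delbourgo
2002 (B) as `LeadingTermClauses W p Dh`, (C) as the typed Kato half `TameBranchRatDvdAt W p` = A227 via
`tameBranchRatDvdAt_of_thmC`, Greenberg 1999 Prop. 3.10 as `prop310_selmerCorank_mod_two_eq_lambdaInvariant`).
No definition, no named fact, no `sorry`.

## What and why

Per cyclotomic dual datum at `rank_ℤ E(ℚ) = 1` with the RATIONAL Kato half `ι g = p^k·B`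
(`g ∈ char_Λ X = (fE)`), `B` bounded by `p^c` with FIRST TOP at `n` (`= λ_an`), `[T¹]B ≠ 0`,
`LHS := ord_p #Ш[p^∞] + ord_p Reg_p(E,Dh) + ord_p ∏c + ord_p ℓ`, `t := ord_p #E(ℚ)_tors`: gen 29 gave the
UPPER bound `LHS ≤ μ(fE) + ord_p[T¹]B + c + 1 + 2t` (`=` iff `λ(fE) = n`); §4 adds the LOWER bound
**`μ(fE) + 1 + 2t ≤ LHS` (`=` iff `λ(fE) = 1`)**, the PARITY **`λ(fE)` ODD** (Greenberg Prop. 3.10 + (A) +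
(B) clause 2), hence at **`n = 3`: `λ(fE) ∈ {1, 3}`** (two-point law `LHS ∈ {μ + 1 + 2t, μ + ord_p[T¹]B
+ c + 1 + 2t}`), and the SQUEEZE: a certified `LHS > μ(fE) + 1 + 2t` — e.g. `μ(fE) ≤ m` and
`m + 1 + 2t < v + ord_p ∏c` with `v ≤ ord_p Reg_p` (x1b's `hb`) — forces `λ(fE) ≥ 3`, at `n = 3` **the
λ-part**, the upper identity and (part 1 §2) **the RATIONAL main conjecture at the pair, exponent
`μ(fE) + c`** (`charIdeal_eq_span_and_iota_eq_of_squeeze_rankOne`); the every-defect and class forms (typed Kato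
half + ANY tuple; PRINT + two values + one Riemann sum) are part 4. Window reading (EVIDENCE; nothing booked): the rank-1 Gord_e346 rows
with `λ_an = 3` — 175a1@5 (`v_5(h) = 2`), 10878bk1@7, 11760bb1@7 (`7² ∣ ∏c`) — meet the squeeze hypothesis
with `m = 0`: there `μ(X) = 0` ALONE forces `λ(X) = 3` and the main conjecture (G) at the pair rationally.
Not given: `μ`; anything at `λ_an ≥ 5` beyond `λ(X) ∈ {1,3,5}`; a booking.

References: Delbourgo 2002 Thm. (A), (B), (C) p. 40 [Delbourgo2002]; Greenberg LNM 1716 Prop. 3.10, §5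
p. 183 [GreenbergLNM1716]; Greenberg–Vatsal 2000 p. 4 [GreenbergVatsal2000]; Washington GTM 83 §7.1
[Washington1997]; `X1/ParitySqueeze.lean`, `X1/RankOneParitySqueeze.lean`, `TameBranchExtraZerosRankOne.lean`. -/

set_option autoImplicit false

noncomputable section

open scoped Classical MatrixGroups ModularForm NumberField

open CongruenceSubgroup IsDedekindDomain WeierstrassCurve NumberField
  Literature.NumberTheory.EllipticCurves
  Literature.NumberTheory.EllipticCurves.ModularForms
  Literature.NumberTheory.EllipticCurves.Rank1Residual
  Literature.NumberTheory.EllipticCurves.Rank1Residual.Typed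
  Literature.NumberTheory.EllipticCurves.Delbourgo2002
  Literature.NumberTheory.EllipticCurves.Greenberg1999
  Summit.BirchSwinnertonDyer.Rank1Residual.X1.MuLambda
  Summit.BirchSwinnertonDyer.Rank1Residual.X1.ParitySqueeze
  Summit.BirchSwinnertonDyer.Rank1Residual.X1.RankOneParitySqueeze
  Summit.BirchSwinnertonDyer.Rank1Residual.X11a.LambdaNorm

namespace Summit.BirchSwinnertonDyer.Rank1Residual.Additive

/-! ### §4 Rank one, per cyclotomic datum: sandwich, parity, dichotomy, squeeze -/

section CoreOne

open TameBranchExtraZeros TameBranchLambdaParity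

variable {W : WeierstrassCurve ℚ} [W.IsElliptic] [W.IsGloballyMinimal] {p : ℕ} [hp : Fact p.Prime]

/-- **THE TWO-SIDED SANDWICH WITH PARITY AT RANK ONE (per cyclotomic datum).** `p ≠ 2`,
`rank_ℤ E(ℚ) = 1`, a (B)-datum `Dh`, a cyclotomic dual datum `D` with `X` torsion and generator `fE`,
`g ∈ char_Λ X` with `ι g = p^k·B`, `‖[Tʲ]B‖ ≤ p^c`, FIRST TOP at `n`, `[T¹]B ≠ 0`, and Greenberg's
Prop. 3.10 (`h310`). With `LHS = ord_p #Ш[p^∞] + ord_p Reg_p + ord_p ∏c + ord_p ℓ`, `t = ord_p #tors`: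
Schneider, `#Ш[p^∞] < ∞`, **`λ(fE)` ODD**, `1 ≤ λ(fE) ≤ n`, `λ(fE) = 1 ∨ 3 ≤ λ(fE)`;
**`μ(fE) + 1 + 2t ≤ LHS` (`=` iff `λ(fE) = 1`)**, `LHS ≤ μ(fE) + ord_p[T¹]B + c + 1 + 2t` (`=` iff
`λ(fE) = n`); at `n = 3` the DICHOTOMY `λ(fE) ∈ {1,3}`; the SQUEEZE `μ(fE) + 1 + 2t < LHS ⟹ 3 ≤ λ(fE)`,
and at `n = 3` **`⟹ λ(fE) = 3` and the upper equality**.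
[cite: Delbourgo2002, Theorem (B) (p. 40)] [cite: GreenbergLNM1716, Prop. 3.10 and §5 p. 183]
[cite: Washington1997, §7.1] -/
theorem sandwich_rankOne_of_iota_eq_of_firstTop
    (h310 : prop310_selmerCorank_mod_two_eq_lambdaInvariant) (hp2 : p ≠ 2)
    (hr1 : W.mordellWeilRank = 1) {Dh : PAdicHeightData W p} (hBcl : LeadingTermClauses W p Dh)
    {κ : ZpExtension ℚ p} {γ : Field.absoluteGaloisGroup ℚ}
    (hκ : κ.IsCyclotomic) (hγ : κ.IsTopGenerator γ) (hγ' : IsCyclotomicVariable p γ)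
    (D : W.SelmerDualData κ γ) [Module.Finite (IwasawaAlgebra p) D.X] (hX : D.IsTorsion)
    {fE g : IwasawaAlgebra p} (hchar : D.charIdeal = Ideal.span {fE}) (hg : g ∈ D.charIdeal)
    {k c : ℕ} {B : PowerSeries ℚ_[p]}
    (hι : iwasawaToPowerSeries p g = PowerSeries.C ((p : ℚ_[p]) ^ k) * B)
    (hbd : ∀ j : ℕ, ‖PowerSeries.coeff j B‖ ≤ (p : ℝ) ^ c)
    {n : ℕ} (hn : ‖PowerSeries.coeff n B‖ = (p : ℝ) ^ c)
    (hlt : ∀ i < n, ‖PowerSeries.coeff i B‖ < (p : ℝ) ^ c) (hB1 : PowerSeries.coeff 1 B ≠ 0) :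
    SchneiderConjecture Dh ∧ Finite (AddCommGroup.primaryComponent W.sha p) ∧
      Odd (lam fE) ∧ 1 ≤ lam fE ∧ lam fE ≤ n ∧ (lam fE = 1 ∨ 3 ≤ lam fE) ∧
      ∃ ℓ : ℕ, ℓ ∣ p ^ 2 ∧ (ReductionNonAnomalous W p → ℓ = 1) ∧
        (X1.MuLambda.mu fE : ℤ) + 1 + 2 * padicValNat p W.torsionOrder ≤
          (padicValNat p (Nat.card (AddCommGroup.primaryComponent W.sha p)) : ℤ) +
            (padicRegulator Dh).valuation + padicValNat p W.tamagawaProduct + padicValNat p ℓ ∧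
        ((X1.MuLambda.mu fE : ℤ) + 1 + 2 * padicValNat p W.torsionOrder =
          (padicValNat p (Nat.card (AddCommGroup.primaryComponent W.sha p)) : ℤ) +
            (padicRegulator Dh).valuation + padicValNat p W.tamagawaProduct + padicValNat p ℓ ↔
          lam fE = 1) ∧
        (padicValNat p (Nat.card (AddCommGroup.primaryComponent W.sha p)) : ℤ) +
            (padicRegulator Dh).valuation + padicValNat p W.tamagawaProduct + padicValNat p ℓ ≤
          X1.MuLambda.mu fE + (PowerSeries.coeff 1 B).valuation + c + 1 +
            2 * padicValNat p W.torsionOrder ∧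
        ((padicValNat p (Nat.card (AddCommGroup.primaryComponent W.sha p)) : ℤ) +
            (padicRegulator Dh).valuation + padicValNat p W.tamagawaProduct + padicValNat p ℓ =
          X1.MuLambda.mu fE + (PowerSeries.coeff 1 B).valuation + c + 1 +
            2 * padicValNat p W.torsionOrder ↔ lam fE = n) ∧
        (n = 3 → lam fE = 1 ∨ lam fE = 3) ∧
        ((X1.MuLambda.mu fE : ℤ) + 1 + 2 * padicValNat p W.torsionOrder <
          (padicValNat p (Nat.card (AddCommGroup.primaryComponent W.sha p)) : ℤ) +
            (padicRegulator Dh).valuation + padicValNat p W.tamagawaProduct + padicValNat p ℓ →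
          3 ≤ lam fE) ∧
        (n = 3 → (X1.MuLambda.mu fE : ℤ) + 1 + 2 * padicValNat p W.torsionOrder <
          (padicValNat p (Nat.card (AddCommGroup.primaryComponent W.sha p)) : ℤ) +
            (padicRegulator Dh).valuation + padicValNat p W.tamagawaProduct + padicValNat p ℓ →
          lam fE = 3 ∧
          (padicValNat p (Nat.card (AddCommGroup.primaryComponent W.sha p)) : ℤ) +
            (padicRegulator Dh).valuation + padicValNat p W.tamagawaProduct + padicValNat p ℓ =
          X1.MuLambda.mu fE + (PowerSeries.coeff 1 B).valuation + c + 1 +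
            2 * padicValNat p W.torsionOrder) := by
  have hpP : p.Prime := hp.out
  have hpQ : (p : ℚ_[p]) ≠ 0 := Nat.cast_ne_zero.mpr hpP.ne_zero
  -- the factorisation `g = fE · h`
  have hg' := hg
  rw [hchar] at hg'
  obtain ⟨h, hh⟩ := Ideal.mem_span_singleton'.mp hg'
  have hfac : g = fE * h := by rw [← hh, mul_comm]
  -- `fE(0) = 0` by clause 1 of (B) at rank one
  have hcl := hBcl κ γ hκ hγ hγ' D hX fE hchar
  have hord1 : (1 : ℕ∞) ≤ fE.order := by
    have h1 := hcl.1
    rwa [hr1, Nat.cast_one] at h1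
  have hf0 : PowerSeries.constantCoeff fE = 0 := by
    rw [← PowerSeries.coeff_zero_eq_constantCoeff_apply]
    exact PowerSeries.coeff_of_lt_order 0 (lt_of_lt_of_le (by exact_mod_cast Nat.zero_lt_one) hord1)
  -- the Λ-algebra cores (gen 29)
  obtain ⟨hf1, hle⟩ := valuation_coeff_one_le hfac hι hbd hf0 hB1
  have hiff := valuation_coeff_one_eq_iff hfac hι hbd hn hf0 hB1
  have hg0 : g ≠ 0 := by
    intro h0
    have : ((PowerSeries.coeff 1 g : ℤ_[p]) : ℚ_[p]) = (p : ℚ_[p]) ^ k * PowerSeries.coeff 1 B := by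
      rw [← Wuthrich2014.coeff_iwasawaToPowerSeries p g 1, hι, PowerSeries.coeff_C_mul]
    rw [h0] at this
    simp only [map_zero, PadicInt.coe_zero] at this
    exact (mul_ne_zero (pow_ne_zero _ hpQ) hB1) this.symm
  have hlamg : lam g = n := lam_eq_of_iota_eq_of_firstTop hg0 hι hbd hn hlt
  have hfE0 : fE ≠ 0 := by intro h0; apply hg0; rw [hfac, h0, zero_mul]
  have hh0 : h ≠ 0 := by intro h0; apply hg0; rw [hfac, h0, mul_zero]
  have hlam_mul : lam g = lam fE + lam h := by rw [hfac]; exact lam_mul hfE0 hh0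
  -- `ord_T fE = 1`
  have hf1Z : PowerSeries.coeff 1 fE ≠ 0 := by
    intro e; apply hf1; rw [e]; simp
  have horder : fE.order = 1 := by
    rw [← Nat.cast_one (R := ℕ∞), PowerSeries.order_eq_nat]
    refine ⟨hf1Z, fun i hi ↦ ?_⟩
    have hi0 : i = 0 := by omega
    subst hi0
    rw [PowerSeries.coeff_zero_eq_constantCoeff_apply]; exact hf0
  have horder' : fE.order = W.mordellWeilRank := by rw [hr1, horder, Nat.cast_one]
  obtain ⟨hS, hfin⟩ := hcl.2.1.mp horder'
  -- `1 ≤ λ(fE) ≤ n`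
  have hlam1 : 1 ≤ lam fE := by
    have h1 := order_le_lam hfE0
    rw [horder] at h1
    exact_mod_cast h1
  have hlamn : lam fE ≤ n := by rw [← hlamg, hlam_mul]; exact Nat.le_add_right _ _
  -- PARITY (Greenberg Prop. 3.10): `λ(fE)` odd
  have hodd : Odd (lam fE) := odd_lam_generator_of_rank_one h310 hp2 hr1 hκ hγ D hX hfE0 hchar hfin
  have hpar : lam fE = 1 ∨ 3 ≤ lam fE := by
    obtain ⟨j, hj⟩ := hodd
    omega
  -- the LOWER sandwich at index `1`
  obtain ⟨hlow, hlowiff⟩ := mu_le_valuation_coeff hfE0 hlam1 hf1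
  -- clause 3 of (B)
  obtain ⟨u, ℓ, hℓp, hℓ1, heq⟩ := hcl.2.2 hS hfin
  rw [hr1, pow_one] at heq
  refine ⟨hS, hfin, hodd, hlam1, hlamn, hpar, ℓ, hℓp, hℓ1, ?_⟩
  obtain ⟨w, hw⟩ := exists_unit_padicLog_cyclotomicGenerator (p := p) hp2
  have hlog0 : padicLog p (cyclotomicGenerator p : ℚ_[p]) ≠ 0 := by
    rw [hw]; exact mul_ne_zero hpQ (coe_units_ne_zero p w)
  have hlogv : (padicLog p (cyclotomicGenerator p : ℚ_[p])).valuation = 1 := by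
    rw [hw, Padic.valuation_mul hpQ (coe_units_ne_zero p w), Padic.valuation_p,
      valuation_coe_units_eq_zero, add_zero]
  have hT0 : W.torsionOrder ≠ 0 := (W.torsionOrder_pos_holds).ne'
  have hTQ : (W.torsionOrder : ℚ_[p]) ≠ 0 := by exact_mod_cast hT0
  have hu0 : ((u : ℤ_[p]) : ℚ_[p]) ≠ 0 := coe_units_ne_zero p u
  have hℓ0 : ℓ ≠ 0 := by
    rintro rfl
    exact hpP.ne_zero (pow_eq_zero_iff (n := 2) (by norm_num) |>.mp (zero_dvd_iff.mp hℓp))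
  have hℓQ : (ℓ : ℚ_[p]) ≠ 0 := by exact_mod_cast hℓ0
  haveI : Finite (AddCommGroup.primaryComponent W.sha p) := hfin
  have hShp0 : (Nat.card (AddCommGroup.primaryComponent W.sha p) : ℚ_[p]) ≠ 0 := by
    exact_mod_cast Nat.card_pos.ne'
  have hRg0 : padicRegulator Dh ≠ 0 := hS
  have hCc0 : (W.tamagawaProduct : ℚ_[p]) ≠ 0 := by
    exact_mod_cast (W.tamagawaProduct_pos_holds : 0 < W.tamagawaProduct).ne'
  have hL : (((PowerSeries.coeff 1 fE : ℤ_[p]) : ℚ_[p]) *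
        padicLog p (cyclotomicGenerator p) * (W.torsionOrder : ℚ_[p]) ^ 2).valuation =
      (((PowerSeries.coeff 1 fE : ℤ_[p]) : ℚ_[p])).valuation + 1 +
        2 * (padicValNat p W.torsionOrder : ℤ) := by
    rw [Padic.valuation_mul (mul_ne_zero hf1 hlog0) (pow_ne_zero 2 hTQ),
      Padic.valuation_mul hf1 hlog0, Padic.valuation_pow, hlogv, Padic.valuation_natCast]
    push_cast
    ring
  have hR : (((u : ℤ_[p]) : ℚ_[p]) * (ℓ : ℚ_[p]) *
        ((Nat.card (AddCommGroup.primaryComponent W.sha p) : ℚ_[p]) * padicRegulator Dh *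
          (W.tamagawaProduct : ℚ_[p]))).valuation =
      (padicValNat p ℓ : ℤ) +
        ((padicValNat p (Nat.card (AddCommGroup.primaryComponent W.sha p)) : ℤ) +
          (padicRegulator Dh).valuation + padicValNat p W.tamagawaProduct) := by
    rw [Padic.valuation_mul (mul_ne_zero hu0 hℓQ) (mul_ne_zero (mul_ne_zero hShp0 hRg0) hCc0),
      Padic.valuation_mul hu0 hℓQ, valuation_coe_units_eq_zero, zero_add, Padic.valuation_natCast,
      Padic.valuation_mul (mul_ne_zero hShp0 hRg0) hCc0, Padic.valuation_mul hShp0 hRg0,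
      Padic.valuation_natCast, Padic.valuation_natCast]
  have hval := congrArg Padic.valuation heq
  rw [hL, hR] at hval
  -- the upper equality criterion in terms of `λ(fE) = n`
  have hupiff : ((padicValNat p (Nat.card (AddCommGroup.primaryComponent W.sha p)) : ℤ) +
        (padicRegulator Dh).valuation + padicValNat p W.tamagawaProduct + padicValNat p ℓ =
      X1.MuLambda.mu fE + (PowerSeries.coeff 1 B).valuation + c + 1 +
        2 * padicValNat p W.torsionOrder ↔ lam fE = n) := by
    rw [← hlamg, ← hiff]
    constructor
    · intro e; linarith
    · intro e; linarith
  -- the lower equality criterion in terms of `λ(fE) = 1`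
  have hlowiff' : ((X1.MuLambda.mu fE : ℤ) + 1 + 2 * padicValNat p W.torsionOrder =
      (padicValNat p (Nat.card (AddCommGroup.primaryComponent W.sha p)) : ℤ) +
        (padicRegulator Dh).valuation + padicValNat p W.tamagawaProduct + padicValNat p ℓ ↔
      lam fE = 1) := by
    rw [← hlowiff]
    constructor
    · intro e; linarith
    · intro e; linarith
  have hsq : (X1.MuLambda.mu fE : ℤ) + 1 + 2 * padicValNat p W.torsionOrder <
      (padicValNat p (Nat.card (AddCommGroup.primaryComponent W.sha p)) : ℤ) +
        (padicRegulator Dh).valuation + padicValNat p W.tamagawaProduct + padicValNat p ℓ →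
      3 ≤ lam fE := by
    intro hlt'
    rcases hpar with h1 | h3
    · exfalso
      have e := hlowiff'.mpr h1
      linarith
    · exact h3
  refine ⟨by linarith, hlowiff', by linarith, hupiff, fun h3 ↦ by omega, hsq, fun h3 hlt' ↦ ?_⟩
  have hlam3 : lam fE = 3 := by
    have := hsq hlt'
    omega
  exact ⟨hlam3, hupiff.mpr (by rw [hlam3, h3])⟩

/-- **THE SQUEEZE ⟹ THE RATIONAL MAIN CONJECTURE AT THE PAIR (rank one, `λ_an = 3`).** In the setting
of `sandwich_rankOne_of_iota_eq_of_firstTop` with `n = 3`, a certified `μ`-bound `μ(fE) ≤ m` and the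
per-pair inequality `m + 1 + 2·ord_p #E(ℚ)_tors < v + ord_p ∏c_ℓ` for a certified `v ≤ ord_p Reg_p(E,Dh)`
(x1b's `hb`; `ord_p #Ш[p^∞], ord_p ℓ ≥ 0` are dropped): then **`λ(fE) = 3`**, and **`char_Λ X = (G)`
with `ι G = p^{μ(fE) + c}·B`** — cc-typer-2's `TameBranchRatCharEqAt` conclusion for THIS tuple and
datum, exponent identified (part 1 §2). With `m = 0`: `μ(X) = 0` alone gives Delbourgo's main
conjecture (G) at the pair, INTEGRALLY in E-normalisation up to `p^c`.
[cite: Delbourgo2002, Theorem (B), (C) (p. 40)] [cite: GreenbergLNM1716, Prop. 3.10 and §5 p. 183]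
[cite: GreenbergVatsal2000, p. 4] [cite: Washington1997, §7.1] -/
theorem charIdeal_eq_span_and_iota_eq_of_squeeze_rankOne
    (h310 : prop310_selmerCorank_mod_two_eq_lambdaInvariant) (hp2 : p ≠ 2)
    (hr1 : W.mordellWeilRank = 1) {Dh : PAdicHeightData W p} (hBcl : LeadingTermClauses W p Dh)
    {κ : ZpExtension ℚ p} {γ : Field.absoluteGaloisGroup ℚ}
    (hκ : κ.IsCyclotomic) (hγ : κ.IsTopGenerator γ) (hγ' : IsCyclotomicVariable p γ)
    (D : W.SelmerDualData κ γ) [Module.Finite (IwasawaAlgebra p) D.X] (hX : D.IsTorsion)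
    {fE g : IwasawaAlgebra p} (hchar : D.charIdeal = Ideal.span {fE}) (hg : g ∈ D.charIdeal)
    {k c : ℕ} {B : PowerSeries ℚ_[p]}
    (hι : iwasawaToPowerSeries p g = PowerSeries.C ((p : ℚ_[p]) ^ k) * B)
    (hbd : ∀ j : ℕ, ‖PowerSeries.coeff j B‖ ≤ (p : ℝ) ^ c)
    (hn : ‖PowerSeries.coeff 3 B‖ = (p : ℝ) ^ c)
    (hlt : ∀ i < 3, ‖PowerSeries.coeff i B‖ < (p : ℝ) ^ c) (hB1 : PowerSeries.coeff 1 B ≠ 0)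
    {m : ℕ} (hμ : X1.MuLambda.mu fE ≤ m) {v : ℤ} (hv : v ≤ (padicRegulator Dh).valuation)
    (hb : (m : ℤ) + 1 + 2 * padicValNat p W.torsionOrder < v + padicValNat p W.tamagawaProduct) :
    lam fE = 3 ∧
      ∃ G : IwasawaAlgebra p, D.charIdeal = Ideal.span {G} ∧
        X1.MuLambda.mu G = X1.MuLambda.mu fE ∧ lam G = 3 ∧
        iwasawaToPowerSeries p G = PowerSeries.C ((p : ℚ_[p]) ^ (X1.MuLambda.mu fE + c)) * B := by
  have hpQ : (p : ℚ_[p]) ≠ 0 := Nat.cast_ne_zero.mpr hp.out.ne_zero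
  obtain ⟨-, hfin, -, -, -, -, ℓ, -, -, -, -, -, -, -, -, hsq3⟩ :=
    sandwich_rankOne_of_iota_eq_of_firstTop h310 hp2 hr1 hBcl hκ hγ hγ' D hX hchar hg hι hbd hn hlt hB1
  haveI : Finite (AddCommGroup.primaryComponent W.sha p) := hfin
  have hSh : (0 : ℤ) ≤ padicValNat p (Nat.card (AddCommGroup.primaryComponent W.sha p)) := by
    exact_mod_cast Nat.zero_le _
  have hℓv : (0 : ℤ) ≤ padicValNat p ℓ := by exact_mod_cast Nat.zero_le _
  have hμ' : (X1.MuLambda.mu fE : ℤ) ≤ m := by exact_mod_cast hμ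
  obtain ⟨hlam3, -⟩ := hsq3 rfl (by linarith)
  refine ⟨hlam3, ?_⟩
  -- the factorisation and part 1 §2
  have hg' := hg
  rw [hchar] at hg'
  obtain ⟨h, hh⟩ := Ideal.mem_span_singleton'.mp hg'
  have hfac : g = fE * h := by rw [← hh, mul_comm]
  have hg0 : g ≠ 0 := by
    intro h0
    have : ((PowerSeries.coeff 1 g : ℤ_[p]) : ℚ_[p]) = (p : ℚ_[p]) ^ k * PowerSeries.coeff 1 B := by
      rw [← Wuthrich2014.coeff_iwasawaToPowerSeries p g 1, hι, PowerSeries.coeff_C_mul]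
    rw [h0] at this
    simp only [map_zero, PadicInt.coe_zero] at this
    exact (mul_ne_zero (pow_ne_zero _ hpQ) hB1) this.symm
  have hlamg : lam g = 3 := TameBranchExtraZeros.lam_eq_of_iota_eq_of_firstTop hg0 hι hbd hn hlt
  have hlameq : lam fE = lam g := by rw [hlam3, hlamg]
  obtain ⟨-, hspan, hμG, hlamG, -⟩ :=
    TameBranchLambdaParity.exists_span_eq_and_iota_eq_zpow_of_lam_eq hfac hg0 hι hlameq
  obtain ⟨-, hιG⟩ := TameBranchLambdaParity.iota_eq_pow_mu_add_of_lam_eq hfac hg0 hι hbd hn hlameq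
  exact ⟨fE * pfree h, by rw [hchar, hspan], hμG, by rw [hlamG, hlam3], hιG⟩

end CoreOne

end Summit.BirchSwinnertonDyer.Rank1Residual.Additive

end
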